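import Summits.ResolutionOfSingularities.ResolutionOfSingularities.Theorems.SubfieldContactFrames
import HarnessLib

/-!
# SubfieldContactCofinite — decomp-res node «SubfieldContact» (lens-6), generation 20, tree file 1/2 of the KERNEL PROOF
of `SubfieldContactAbs` (window-g20 item (M1), CRITIC-LEDGER rows 147b/147c/147d): COFINITE `p`-INDEPENDENCE

WRITER PROVENANCE (decomp-res-writer-1 g8, 2026-08-30T23:38:31Z): landed VERBATIM from
`HOME/decomp-res-lens-6/g20/tree/SubfieldContactCofinite.lean` (sha256 ebfc8dfe…; node `g20/SubfieldContactStalk.lean`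
9720d307, PIN 2026-08-30T23:22:49Z) under CRITIC-LEDGER row 152 (CLEARED, lens-6 g20 MAP +1 (M1)); writer changes =
the file-level linter option dropped (tree lint) and docstring line wraps only. Supports item
stmt-ResolutionOfSingularities-26971 (`MaxContactCut.SCE1NoSubDvd`); first of three files (Cofinite → Stalk → in-cone
MaxContactCutSubfieldContactStalk).

= §12a–§12b of the node file `HOME/decomp-res-lens-6/g20/SubfieldContactStalk.lean` (HOME = run/shared/lean/pub/decomp-res),
split for the 400-line limit; cone-free (imports only `SubfieldContactFrames`); namespace of the node.

* §12a `map_powAdjoin_subset` — the image of `k^{(q)}(Λ)` under a ring map lies in any subring containing all `q`-th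
  powers and the image of `Λ` (`x⁻¹ = x^{q-1}·(x⁻¹)^q`).
* §12b `CofinitePIndep p` and its KERNEL PROOF `cofinitePIndep_holds`: for an absolute `p`-basis `B` of `k` and a FINITE
  extension `K ⊇ k`, all but finitely many elements of `B` stay `p`-independent over `K^p` in `K`.  ELEMENTARY DEGREE
  COUNT (no Kähler differentials, no Cartier equality): for a finite `t ⊆ B`, `p^{#t} = [k^p(t) : k^p] ≤ [K : k] ·
  [K^p(κ t) : K^p]` (`pow_card_le_mul_finrank_adjoin`) and `[K^p(κ t) : K^p] = p^r`, `r ≤ #t`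
(`exists_finrank_adjoin_eq_pow`);
  so the DEFECT `#t - r` has `p^{#t - r} ≤ [K : k]`; a finite `t₀ ⊆ B` of MAXIMAL defect is the exceptional set: for
  `t ⊆ B ∖ t₀` sub-multiplicativity of degrees (`IntermediateField.finrank_sup_le`) forces defect zero, i.e.
  `p`-independence.  (Matsumura §26 proves the cofiniteness through `rk Ω_{K/k} < ∞`; here the degree count replaces it.)

(Sources: Matsumura1987 §26 Thm 26.5–26.10; EGAIV4 §16.8 / 0_IV 21.4.)
-/

noncomputable section

open CategoryTheory AlgebraicGeometry TopologicalSpace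
open Literature.AlgebraicGeometry.Resolution
open Summit.ResolutionOfSingularities.ResolutionOfSingularities.Theorems
open WeakOrderReduction ForcedTowerClasses PurityValveClasses
open IsLocalRing MvPolynomial
open AbsoluteContactClasses (IsAbsContactAt SepResidueAt diffIdeal_restrict_le stalkMap_comp_toStalk_eq_stalkHom
  IsQFrame boxMon taylorMon uMon uMon_eq_eval hsCoeff_uMon module_finite_residueField_of_isClosed
  pcl mem_pcl_of_mem_adjoin forall_mem_pcl_pow exists_finset_span_pcl exists_finset_span_pcl_pow
  qIndep_of_isPIndependent QIndep frobSubring genSubring pow_mem_frobSubring apply_mem_frobSubring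
  frobSubring_le_genSubring pow_mem_genSubring isQFrame_frobSubring)
open HugValuationCut (PPowerFormAt not_isAbsContactAt_of_pPowerFormAt essFiniteType_stalk
  stalkIdeal_le_and_not_le_of_idealOrder isUnit_natCast_of_not_dvd exists_hasse_apply_of_not_mem_pPowerSpan
  exists_hasse_apply_mem_and_notMem_sq)
open scoped BigOperators

namespace Summit.ResolutionOfSingularities.ResolutionOfSingularities.Theorems.SubfieldContactClasses

/-! ## §12 PIECE L1-abs `StalkSubfieldContactAbs` PROVED — and with it the lemma `SubfieldContactAbs` -/

/-! ### §12a A closure lemma -/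

/-- images of a subfield generated by `q`-th powers and `Λ` under a ring map into a ring lie in any subring containing
all `q`-th powers and the image of `Λ` (`x⁻¹ = x^{q-1} (x⁻¹)^q`). [folklore] -/
theorem map_powAdjoin_subset {k : Type} [Field k] {S : Type} [CommRing S] (φ : k →+* S) {q : ℕ} (hq : 0 < q)
    (Λ : Set k) (C : Subring S) (hpow : ∀ s : S, s ^ q ∈ C) (hΛ : ∀ x ∈ Λ, φ x ∈ C) :
    ∀ c ∈ powAdjoin k q Λ, φ c ∈ C := by
  intro c hc
  have hsub : Subring.closure ((Set.range fun x : k => x ^ q) ∪ Λ) ≤ C.comap φ := by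
    rw [Subring.closure_le]
    rintro x (⟨y, rfl⟩ | hx)
    · rw [SetLike.mem_coe, Subring.mem_comap, map_pow]; exact hpow _
    · rw [SetLike.mem_coe, Subring.mem_comap]; exact hΛ x hx
  obtain ⟨y, hy, z, hz, rfl⟩ := (Subfield.mem_closure_iff).mp hc
  by_cases hz0 : z = 0
  · rw [hz0, div_zero, map_zero]; exact C.zero_mem
  have hinv : z ^ (q - 1) * (z⁻¹) ^ q = z⁻¹ := by
    have h1 : z ^ q = z ^ (q - 1) * z := by rw [← pow_succ, Nat.sub_add_cancel hq]
    rw [inv_pow, h1, mul_inv, ← mul_assoc, mul_inv_cancel₀ (pow_ne_zero _ hz0), one_mul]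
  rw [div_eq_mul_inv, ← hinv, map_mul, map_mul, map_pow, map_pow]
  exact C.mul_mem (hsub hy) (C.mul_mem (C.pow_mem (hsub hz) _) (hpow _))

/-! ### §12b (statement) Cofinite `p`-independence survives a finite extension -/

/-- **Cofinite `p`-independence**: if `B` is an absolute `p`-basis of `k` and `K ⊇ k` is a finite extension, then
all but finitely many elements of `B` stay `p`-independent over `K^p` in `K`. (Matsumura1987 §26) -/
def CofinitePIndep (p : ℕ) [Fact p.Prime] : Prop :=
  ∀ (k K : Type) [Field k] [Field K] [CharP k p] [CharP K p] [Algebra k K] [Module.Finite k K] (B : Set k),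
    IsPBasis p k B →
      ∃ S₀ : Finset k, (↑S₀ : Set k) ⊆ B ∧
        IsPIndependent (F := ↥(frobenius K p).fieldRange) p (algebraMap k K '' (B \ ↑S₀))

/-! ### §12b (kernel) Cofinite `p`-independence survives a finite extension — the degree count -/

section CofinitePIndependence

open scoped IntermediateField

variable (p : ℕ) [hpF : Fact p.Prime]

/-- degrees of finite height-one purely inseparable adjunctions are powers of `p`. (Matsumura1987 §26) [folklore] -/
theorem exists_finrank_adjoin_eq_pow {F E : Type*} [Field F] [Field E] [Algebra F E] [CharP E p] (u : Finset E)
    (hu : ∀ x ∈ u, x ^ p ∈ (algebraMap F E).range) :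
    ∃ r : ℕ, r ≤ u.card ∧ Module.finrank F ↥(IntermediateField.adjoin F (u : Set E)) = p ^ r := by
  classical
  induction u using Finset.induction_on with
  | empty =>
    exact ⟨0, le_rfl, by
      rw [Finset.coe_empty, IntermediateField.adjoin_empty, IntermediateField.finrank_bot, pow_zero]⟩
  | insert a u hau ih =>
    obtain ⟨r, hr, hru⟩ := ih (fun x hx => hu x (Finset.mem_insert_of_mem hx))
    set L := IntermediateField.adjoin F (u : Set E) with hL
    have hap : a ^ p ∈ L := by
      obtain ⟨c, hc⟩ := hu a (Finset.mem_insert_self a u)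
      rw [← hc]; exact L.algebraMap_mem c
    by_cases ha : a ∈ L
    · have h1 : Module.finrank L L⟮a⟯ = 1 := by
        rw [IntermediateField.finrank_adjoin_simple_eq_one_iff, IntermediateField.mem_bot]
        exact ⟨⟨a, ha⟩, rfl⟩
      refine ⟨r, hr.trans ?_, ?_⟩
      · rw [Finset.card_insert_of_notMem hau]; exact Nat.le_succ _
      · rw [Finset.coe_insert, finrank_adjoin_insert, h1, mul_one, hru]
    · refine ⟨r + 1, ?_, ?_⟩
      · rw [Finset.card_insert_of_notMem hau]; exact Nat.succ_le_succ hr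
      · rw [Finset.coe_insert, finrank_adjoin_insert, finrank_adjoin_simple_eq_of_pow_mem p L hap ha, hru,
          pow_succ]

/-- **The key inequality**: for `B` `p`-independent over `k^p` in `k`, `[K : k] = m < ∞` and a finite `t ⊆ B`,
`p^{#t} ≤ m · [K^p(κ t) : K^p]` (compare the `k^p`-dimensions of `k^p(t) ↪ K^p(κ t) ⊆ span_{k^p}{x_i^p w_j}` for a
`k`-basis `x_i` of `K` and a `K^p`-basis `w_j` of `K^p(κ t)`). (Matsumura1987 §26) [folklore] -/
theorem pow_card_le_mul_finrank_adjoin {k K : Type} [Field k] [Field K] [DecidableEq K] [CharP K p]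
    [Algebra k K] [Module.Finite k K] {B : Set k} (hB : IsPIndependent (F := ↥(powAdjoin k p ∅)) p B)
    (t : Finset k) (ht : (↑t : Set k) ⊆ B) :
    p ^ t.card ≤ Module.finrank k K * Module.finrank (↥(frobenius K p).fieldRange)
      ↥(IntermediateField.adjoin (↥(frobenius K p).fieldRange) ((t.image (algebraMap k K) : Finset K) : Set K)) := by
  classical
  have hp : p.Prime := Fact.out
  set κ := algebraMap k K with hκ
  set k₁ : Subfield k := powAdjoin k p ∅ with hk₁
  set Kp : Subfield K := (frobenius K p).fieldRange with hKp
  set W := IntermediateField.adjoin (↥Kp) ((t.image κ : Finset K) : Set K) with hW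
  have hexp : ∀ x : K, x ^ p ∈ (algebraMap (↥Kp) K).range := fun x =>
    ⟨⟨x ^ p, RingHom.mem_fieldRange.mpr ⟨x, frobenius_def ..⟩⟩, rfl⟩
  haveI : FiniteDimensional (↥Kp) ↥W := finiteDimensional_adjoin_of_pow_mem p _ (fun x _ => hexp x)
  let bK := Module.finBasis k K
  let bW := Module.finBasis (↥Kp) ↥W
  -- the comparison module: the `k₁`-span of the products `x_i^p · w_j`
  let gen : Fin (Module.finrank k K) × Fin (Module.finrank (↥Kp) ↥W) → K :=
    fun ij => (bK ij.1) ^ p * ((bW ij.2 : ↥W) : K)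
  let Wm : Submodule (↥k₁) K := Submodule.span (↥k₁) (Set.range gen)
  have hWm_fin : Module.finrank (↥k₁) ↥Wm ≤ Module.finrank k K * Module.finrank (↥Kp) ↥W := by
    refine (finrank_range_le_card gen).trans ?_
    rw [Fintype.card_prod, Fintype.card_fin, Fintype.card_fin]
  haveI : Module.Finite (↥k₁) ↥Wm := Module.Finite.span_of_finite _ (Set.finite_range gen)
  -- `κ(k^p) ⊆ K^p`
  have hk₁Kp : ∀ c ∈ k₁, κ c ∈ Kp := fun c hc =>
    map_powAdjoin_subset κ hp.pos ∅ Kp.toSubring (fun s => RingHom.mem_fieldRange.mpr ⟨s, frobenius_def ..⟩)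
      (fun x hx => absurd hx (Set.notMem_empty x)) c hc
  -- `W ⊆ Wm`
  have hWWm : ∀ w : K, w ∈ W → w ∈ Wm := by
    intro w hw
    set c := bW.repr ⟨w, hw⟩ with hc
    have hrepr : ((∑ j, c j • bW j : ↥W) : K) = w := by
      rw [bW.sum_repr ⟨w, hw⟩]
    have hcoe : ((∑ j, c j • bW j : ↥W) : K) = ∑ j, ((c j : ↥Kp) : K) * ((bW j : ↥W) : K) := by
      change W.val (∑ j, c j • bW j) = _
      rw [map_sum]
      refine Finset.sum_congr rfl fun j _ => ?_
      rw [map_smul, Algebra.smul_def]; rfl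
    rw [← hrepr, hcoe]
    refine Submodule.sum_mem _ fun j _ => ?_
    obtain ⟨yj, hyj⟩ := RingHom.mem_fieldRange.mp (c j).2
    have hyj' : ((c j : ↥Kp) : K) = ∑ i, (bK.repr yj i) ^ p • (bK i) ^ p := by
      rw [← hyj]
      have e : (frobenius K p) yj = frobenius K p (∑ i, bK.repr yj i • bK i) := by rw [bK.sum_repr]
      rw [e, map_sum]
      refine Finset.sum_congr rfl fun i _ => ?_
      rw [frobenius_def, smul_pow]
    rw [hyj', Finset.sum_mul]
    refine Submodule.sum_mem _ fun i _ => ?_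
    rw [smul_mul_assoc]
    have hmem : (bK.repr yj i) ^ p ∈ k₁ := Subfield.subset_closure (Or.inl ⟨_, rfl⟩)
    change ((⟨(bK.repr yj i) ^ p, hmem⟩ : ↥k₁) • ((bK i) ^ p * ((bW j : ↥W) : K))) ∈ Wm
    exact Submodule.smul_mem _ _ (Submodule.subset_span ⟨(i, j), rfl⟩)
  -- `κ(k^p(t)) ⊆ W`
  set V := IntermediateField.adjoin (↥k₁) (t : Set k) with hV
  have hVW : ∀ v : k, v ∈ V → κ v ∈ W := by
    intro v hv
    have h1 : v ∈ V.toSubfield := hv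
    rw [hV, IntermediateField.adjoin_toSubfield] at h1
    refine (Subfield.closure_le (t := W.toSubfield.comap κ)).mpr ?_ h1
    rintro x (⟨c, rfl⟩ | hx)
    · show κ (c : k) ∈ W
      exact W.algebraMap_mem (⟨κ c, hk₁Kp c c.2⟩ : ↥Kp)
    · show κ x ∈ W
      exact IntermediateField.subset_adjoin _ _ (by rw [Finset.coe_image]; exact ⟨x, hx, rfl⟩)
  -- the `k₁`-linear structure map `k → K` restricted to `V → Wm` is injective
  let κ₁ : k →ₗ[↥k₁] K :=
    { toFun := κ
      map_add' := map_add κ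
      map_smul' := fun c x => by
        rw [RingHom.id_apply, Subfield.smul_def, Subfield.smul_def, smul_eq_mul, map_mul, Algebra.smul_def] }
  let fV : ↥V →ₗ[↥k₁] ↥Wm :=
    LinearMap.codRestrict Wm (κ₁.comp V.val.toLinearMap) (fun v => hWWm _ (hVW v v.2))
  have hfV : Function.Injective fV := by
    intro a b hab
    have h := congrArg (fun w : ↥Wm => (w : K)) hab
    exact Subtype.ext (κ.injective h)
  have h1 : Module.finrank (↥k₁) ↥V ≤ Module.finrank (↥k₁) ↥Wm := LinearMap.finrank_le_finrank_of_injective hfV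
  rw [hV, hB t ht] at h1
  exact h1.trans hWm_fin

/-- **KERNEL: `CofinitePIndep p`** — for an absolute `p`-basis `B` of `k` and a finite extension `K ⊇ k`, all but
finitely many elements of `B` stay `p`-independent over `K^p` (maximal defect `#t − log_p [K^p(κ t) : K^p] ≤ [K : k]`).
(Matsumura1987 §26) [folklore] -/
theorem cofinitePIndep_holds : CofinitePIndep p := by
  intro k K _ _ _ _ _ _ B hBasis
  classical
  have hp : p.Prime := Fact.out
  set κ := algebraMap k K with hκ
  set Kp : Subfield K := (frobenius K p).fieldRange with hKp
  have hexp : ∀ x : K, x ^ p ∈ (algebraMap (↥Kp) K).range := fun x =>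
    ⟨⟨x ^ p, RingHom.mem_fieldRange.mpr ⟨x, frobenius_def ..⟩⟩, rfl⟩
  let f : Finset K → ℕ := fun t' => Module.finrank (↥Kp) ↥(IntermediateField.adjoin (↥Kp) (t' : Set K))
  have hfpow : ∀ t' : Finset K, ∃ r, r ≤ t'.card ∧ f t' = p ^ r := fun t' =>
    exists_finrank_adjoin_eq_pow p t' (fun x _ => hexp x)
  have hfin : ∀ t' : Finset K, FiniteDimensional (↥Kp) ↥(IntermediateField.adjoin (↥Kp) (t' : Set K)) :=
    fun t' => finiteDimensional_adjoin_of_pow_mem p _ (fun x _ => hexp x)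
  set m := Module.finrank k K with hm
  have hkey : ∀ t : Finset k, (↑t : Set k) ⊆ B → p ^ t.card ≤ m * f (t.image κ) := fun t ht =>
    pow_card_le_mul_finrank_adjoin p hBasis.1 t ht
  -- the defect predicate and its maximum
  let P : ℕ → Prop := fun δ => ∃ t : Finset k, ∃ r : ℕ, (↑t : Set k) ⊆ B ∧ f (t.image κ) = p ^ r ∧
    r ≤ t.card ∧ t.card - r = δ
  have hP0 : P 0 := by
    refine ⟨∅, 0, by simp, ?_, le_rfl, rfl⟩
    show Module.finrank (↥Kp) ↥(IntermediateField.adjoin (↥Kp) (((∅ : Finset k).image κ : Finset K) : Set K)) = p ^ 0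
    rw [Finset.image_empty, Finset.coe_empty, IntermediateField.adjoin_empty, pow_zero]
    exact IntermediateField.finrank_bot
  have hPbound : ∀ δ, P δ → δ ≤ m := by
    rintro δ ⟨t, r, ht, hr, hrt, rfl⟩
    have h1 := hkey t ht
    rw [hr, ← Nat.sub_add_cancel hrt, pow_add] at h1
    have h2 : p ^ (t.card - r) ≤ m := Nat.le_of_mul_le_mul_right h1 (pow_pos hp.pos r)
    exact (Nat.lt_pow_self hp.one_lt).le.trans h2
  obtain ⟨t₀, r₀, ht₀B, hr₀, hr₀t, hδ₀⟩ : P (Nat.findGreatest P m) := Nat.findGreatest_spec (Nat.zero_le m) hP0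
  have hmax : ∀ δ, P δ → δ ≤ Nat.findGreatest P m := fun δ hδ => Nat.le_findGreatest (hPbound δ hδ) hδ
  refine ⟨t₀, ht₀B, ?_⟩
  intro t' ht'
  obtain ⟨t, htB, rfl⟩ := Finset.subset_set_image_iff.mp ht'
  have htcard : (t.image κ).card = t.card := Finset.card_image_of_injective _ κ.injective
  rw [htcard]
  -- `t ⊆ B ∖ t₀`: compare the defects of `t₀` and `t₀ ∪ t`
  have hdisj : Disjoint t₀ t := by
    rw [Finset.disjoint_left]
    intro x hx₀ hxt
    exact (htB hxt).2 hx₀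
  have hUB : (↑(t₀ ∪ t) : Set k) ⊆ B := by
    rw [Finset.coe_union]; exact Set.union_subset ht₀B fun x hx => (htB hx).1
  have hcardU : (t₀ ∪ t).card = t₀.card + t.card := Finset.card_union_of_disjoint hdisj
  obtain ⟨r₁, hr₁le, hr₁⟩ := hfpow ((t₀ ∪ t).image κ)
  have hr₁le' : r₁ ≤ t₀.card + t.card := by
    rw [← hcardU]; exact hr₁le.trans Finset.card_image_le
  have h1 : t₀.card + t.card - r₁ ≤ Nat.findGreatest P m :=
    hmax _ ⟨t₀ ∪ t, r₁, hUB, hr₁, by omega, by rw [hcardU]⟩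
  have h2 : r₀ + t.card ≤ r₁ := by omega
  obtain ⟨r, hrle, hr⟩ := hfpow (t.image κ)
  have h3 : f ((t₀ ∪ t).image κ) ≤ f (t₀.image κ) * f (t.image κ) := by
    haveI := hfin (t₀.image κ)
    haveI := hfin (t.image κ)
    show Module.finrank (↥Kp) ↥(IntermediateField.adjoin (↥Kp) (((t₀ ∪ t).image κ : Finset K) : Set K)) ≤ _
    rw [Finset.image_union, Finset.coe_union, IntermediateField.adjoin_union]
    exact IntermediateField.finrank_sup_le _ _
  rw [hr₁, hr₀, hr, ← pow_add] at h3
  have h4 : r₁ ≤ r₀ + r := (Nat.pow_le_pow_iff_right hp.one_lt).mp h3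
  have h5 : t.card ≤ r := by omega
  have hrle' : r ≤ t.card := htcard ▸ hrle
  show f (t.image κ) = p ^ t.card
  rw [hr, le_antisymm hrle' h5]

end CofinitePIndependence

end Summit.ResolutionOfSingularities.ResolutionOfSingularities.Theorems.SubfieldContactClasses

end
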